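import Summits.BirchSwinnertonDyer.BirchSwinnertonDyer.Theorems.AlignedTransportAtTwoMainConjectureOfRankZeroBSDAtTwoHalfDescentBaseIndexNoFinite
import Summits.BirchSwinnertonDyer.BirchSwinnertonDyer.Theorems.AlignedTransportAtTwoMainConjectureOfRankZeroBSDAtTwoHalfDescentBaseIndexDoorLayers
import Summits.BirchSwinnertonDyer.BirchSwinnertonDyer.Theorems.AlignedTransportAtTwoMainConjectureOfRankZeroBSDAtTwoHalfDescentLayerIndexGrowthExact
import HarnessLib

/-!
# Route `AlignedTransportAtTwo`, crux C2 `MainConjectureOfRankZeroBSDAtTwo` (stmt-BirchSwinnertonDyer-22298):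
# THE BASE TERM CARRIES `p^μ`, XIV — THE SEED'S LAYER NUMBERS ARE RESULTANT NORMS: with no finite submodule (file XIII) the lineage's exact tower product is HYPOTHESIS-FREE on the
# seed cell — `#Sel_{2^∞}(W/ℚ_n)·#ker g_n = 2^{𝔢} · ∏_{m<n} #Λ/(f_X, Ψ_m)` at EVERY layer of the rank-`0` tower, each factor `#Λ/(f_X, Ψ_m) = 2^{v_m}` with `v_m ≥ 1`
# (`𝔢 = ord₂ Tam(W) + 2·ord₂ #W̃(𝔽₂) + ord₂ #Sel_{2^∞}(W/ℚ)`; `#Λ/(f, Ψ_m) = |N_{ℚ₂(ζ_{2^{m+1}})/ℚ₂} f(ζ_{2^{m+1}} − 1)|₂⁻¹`)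

HONEST FRAMING (cell `bsd-f1-sign2`, WIDTH-5 attached prover seat `bsd-line-att-p5` gen 61 on line `birth` of the lead `bsd-line-att-p2`;
`--supports` stmt-BirchSwinnertonDyer-22298, closes nothing; BSD is NOT proved by any of this; the crux C2, its verdict «blocked-on
`Rank1Residual.GreenbergMuConjectureIrreducible`» and every registered stub (P / T / Kμ / LimDoor / MuIneqʳ / PFμ⁺) are untouched). THEOREMS ONLY — no `def`,
no instance, no named fact, no `sorry`; print-free. Gens 54–55 proved the exact tower product `#(X/ω_nX) = #(X/TX)·∏_{m<n} #(X/Ψ_mX)` and `#(X/Ψ_mX) = #Λ/(f_X,Ψ_m)` for modules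
WITHOUT finite submodule (`…LayerIndexTower.natCard_quotient_omega_eq_mul_prod`, `…LayerIndexCertificate.natCard_quotient_smul_top_eq_natCard_quotient_span_sup`); file XIII
(`…BaseIndexNoFinite.forall_finite_submodule_eq_bot_seed`) discharges that hypothesis for every seed, file XI (`…BaseIndexEuler`) evaluates `#(X/TX) = 2^{𝔢}`, and Lemma 4.3 with
`#ker h_n = 1` on the cell reads the left side honestly.

* §1 (`ℚ`, good ordinary `p`, `#W̃(𝔽_p) = p^k` pure, `W(ℚ)[p] = 0`, `#Sel_{p^∞}(W/ℚ) = p^s`, rank-`0` tower `∀ n, 0 < #Sel_{p^∞}(W/ℚ_n)·#ker g_n`, `char_Λ X = (f_X)`)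
  ★★★ `natCard_selmerLayer_mul_kerG_eq_pow_mul_prod_of_pure`: **`#Sel_{p^∞}(W/ℚ_n)·#ker g_n = p^{v+2k+s} · ∏_{m<n} #Λ/(f_X, Ψ_m)`** for every `n`;
  ★★ `natCard_selmerInvariants_eq_pow_mul_prod_of_pure`: the same for `#Sel_{p^∞}(W/ℚ_∞)^{Γ_n}`.
* §2 (`p = 2`, THE SEED CELL: good ordinary at `2`, no rational `2`-torsion abscissa, `#Sel_{2^∞}(W/ℚ) = 2^s`, rank-`0` tower) ★★★ `natCard_selmerLayer_mul_kerG_eq_seed`: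
  **`#Sel_{2^∞}(W/ℚ_n)·#ker g_n = 2^{𝔢} · ∏_{m<n} #Λ/(f_X, Ψ_m)`**; ★★ `exists_layerExponents_seed`: there are `v_m ≥ 1` with **`#Λ/(f_X,Ψ_m) = 2^{v_m}`** and
  **`#Sel_{2^∞}(W/ℚ_n)·#ker g_n = 2^{𝔢 + Σ_{m<n} v_m}`** for every `n` — the honest layer numbers of a seed are `2^{𝔢}` times resultant norms of its characteristic series at the
  `2`-power cyclotomic points; under Mazur's main conjecture `f_X ∼ L₂(W,T)` and `v_m = ord₂ N(L₂(W, ζ_{2^{m+1}}−1))` is a modular-symbol number.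
* §3 (`p = 2` seed cell, `λ₂ < 2ⁿ`) ★★★ `natCard_selmerLayer_succ_mul_kerG_eq_seed`: **`#Sel_{2^∞}(W/ℚ_{n+1})·#ker g_{n+1} = 2^{2ⁿμ₂ + λ₂}·#Sel_{2^∞}(W/ℚ_n)·#ker g_n`** (gen 56's
  exact law with `F = 0` by file XIII); ★★★ `mu_eq_zero_iff_layer_seed`: **`μ₂ = 0 ⟺ #Sel_{n+1}·#ker g_{n+1} < 2^{2ⁿ}·#Sel_n·#ker g_n`** — the one-layer door is EXACT (necessary and sufficient)
  on the seed cell; ★★ `mu_eq_div_and_lambda_eq_mod_seed`: the ratio `2^e` of two consecutive honest layer numbers reads **`μ₂ = e / 2ⁿ`, `λ₂ = e % 2ⁿ`**.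
Reading for the next LEAD / -data: a certificate for stub T at a seed is a statement about the sequence `(v_m)`: `μ₂ = 0 ⟺ v_m = λ₂` for all `2^m > λ₂` (gens 54–56), and the
anti-MC alternatives `P_alg ∣ P_an`, `P_alg ≠ P_an` predict a DIFFERENT sequence — one honest layer number past the divergence point decides. Nothing numerical is asserted about any
curve; C2 untouched. Memo `Cruxes/MainConjectureOfRankZeroBSDAtTwo/EULER-BRIDGE-att-p5-g61.md`.

References: R. Greenberg, LNM 1716 (1999), §4 Thm. 4.1, Lemmas 4.2–4.3, Prop. 4.14 [GreenbergLNM1716]; L. Washington, GTM 83, §13.3 (Lemma 13.18, Thm. 13.13) [Washington1997];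
W. Fulton, *Intersection Theory*, Lemma A.2.6 [Fulton1998].
-/

set_option linter.dupNamespace false
set_option autoImplicit false

noncomputable section

open scoped Classical Polynomial

universe u

namespace Summit.BirchSwinnertonDyer.BirchSwinnertonDyer.Theorems.AlignedTransportAtTwoHalfDescentBaseIndexLayerNumbers

open WeierstrassCurve Literature.NumberTheory.EllipticCurves Literature.NumberTheory.EllipticCurves.IwasawaAlgebra
  Literature.NumberTheory.EllipticCurves.Rank1Residual
  Summit.BirchSwinnertonDyer.Rank1Residual.X1.MuLambda
  Summit.BirchSwinnertonDyer.Rank1Residual.X1.MuPart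
  Summit.BirchSwinnertonDyer.Rank1Residual.X1.ParitySqueeze
  Summit.BirchSwinnertonDyer.Rank1Residual.X1.GeneratorBoundMu
  Summit.BirchSwinnertonDyer.Rank1Residual.Iwasawa
  Summit.BirchSwinnertonDyer.BirchSwinnertonDyer.Theorems
  Summit.BirchSwinnertonDyer.BirchSwinnertonDyer.Theorems.DefectPrime
  Summit.BirchSwinnertonDyer.BirchSwinnertonDyer.Theorems.AlignedTransportAtTwoHalfDescentLayerIndexGrowthExact
  Summit.BirchSwinnertonDyer.BirchSwinnertonDyer.Theorems.AlignedTransportAtTwoHalfDescentLayerIndex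
  Summit.BirchSwinnertonDyer.BirchSwinnertonDyer.Theorems.AlignedTransportAtTwoHalfDescentLayerIndexTower
  Summit.BirchSwinnertonDyer.BirchSwinnertonDyer.Theorems.AlignedTransportAtTwoHalfDescentLayerIndexCertificate
  Summit.BirchSwinnertonDyer.BirchSwinnertonDyer.Theorems.AlignedTransportAtTwoHalfDescentLayerIndexSelmer
  Summit.BirchSwinnertonDyer.BirchSwinnertonDyer.Theorems.AlignedTransportAtTwoHalfDescentLayerIndexGrowthFiniteCell
  Summit.BirchSwinnertonDyer.BirchSwinnertonDyer.Theorems.AlignedTransportAtTwoHalfDescentBaseIndex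
  Summit.BirchSwinnertonDyer.BirchSwinnertonDyer.Theorems.AlignedTransportAtTwoHalfDescentBaseIndexSelmer
  Summit.BirchSwinnertonDyer.BirchSwinnertonDyer.Theorems.AlignedTransportAtTwoHalfDescentBaseIndexRankZero
  Summit.BirchSwinnertonDyer.BirchSwinnertonDyer.Theorems.AlignedTransportAtTwoHalfDescentBaseIndexEuler
  Summit.BirchSwinnertonDyer.BirchSwinnertonDyer.Theorems.AlignedTransportAtTwoHalfDescentBaseIndexDoorLayers
  Summit.BirchSwinnertonDyer.BirchSwinnertonDyer.Theorems.AlignedTransportAtTwoHalfDescentBaseIndexNoFinite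

/-! ## §1 `ℚ`, good ordinary `p` with pure point count: the honest layer numbers as a product of resultant norms -/

section Rat

variable (W : WeierstrassCurve ℚ) [W.IsElliptic] [W.IsGloballyMinimal] {p : ℕ} [hp : Fact p.Prime] (κ : ZpExtension ℚ p) {γ : Field.absoluteGaloisGroup ℚ}

/-- ★★ **`#Sel_{p^∞}(W/ℚ_∞)^{Γ_n} = p^{v+2k+s} · ∏_{m<n} #Λ/(f_X, Ψ_m)` at every layer** — `W/ℚ` globally minimal, good ORDINARY at `p` with `#W̃(𝔽_p) = p^k`, `W(ℚ)[p] = 0`, `κ` cyclotomic with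
generator `γ`, ANY dual datum with `char_Λ X = (f_X)`, `#Sel_{p^∞}(W/ℚ) = p^s`, rank-`0` tower (`∀ n, 0 < #Sel_{p^∞}(W/ℚ_∞)^{Γ_n}`). The exact tower product of gens 54–55 with the
no-finite-submodule hypothesis discharged by file XIII and the base factor evaluated by file XI. [cite: GreenbergLNM1716, §4 Thm. 4.1, Lemma 4.2, Prop. 4.14] [cite: Washington1997, §13.3 Lemma 13.18] -/
theorem natCard_selmerInvariants_eq_pow_mul_prod_of_pure (hgo : GoodOrd W p) (hκ : κ.IsCyclotomic) (hγ : κ.IsTopGenerator γ) (hK : ∀ P : W.toAffine.Point, p • P = 0 → P = 0)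
    {k : ℕ} (hN : W.reductionPointCount p = p ^ k) (D : W.SelmerDualData κ γ) [hSel : Finite (W.selmerGroupPInfty p)] {s : ℕ} (hs : Nat.card (W.selmerGroupPInfty p) = p ^ s)
    {f : IwasawaAlgebra p} (hchar : D.charIdeal = Ideal.span {f}) (hpos : ∀ n, 0 < Nat.card ↥(W.selmerInfty κ ⊓ W.layerInvariants κ n)) (n : ℕ) :
    Nat.card ↥(W.selmerInfty κ ⊓ W.layerInvariants κ n) =
      p ^ (padicValNat p W.tamagawaProduct + 2 * k + s) *
        ∏ m ∈ Finset.range n, Nat.card (IwasawaAlgebra p ⧸ (Ideal.span {f} ⊔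
          Ideal.span {((((Polynomial.cyclotomic (p ^ (m + 1)) ℤ_[p]).comp (Polynomial.X + 1) : ℤ_[p][X]) : IwasawaAlgebra p))})) := by
  haveI : Module.Finite (IwasawaAlgebra p) D.X := D.module_finite_holds hγ
  have hD : D.IsTorsion := D.isTorsion_of_finite_selmerGroup_rat hκ (W.hasGoodReductionAt_and_hasUnitRootAt_of_rat hgo.1 hgo.2) hγ hSel
  have hnf := forall_finite_submodule_eq_bot_of_pure W κ hgo hκ hγ hK hN D hs
  have hpos' : ∀ n, 0 < Nat.card (D.X ⧸ (Ideal.span {((1 + PowerSeries.X : PowerSeries ℤ_[p]) ^ (p ^ n) - 1 : IwasawaAlgebra p)} • ⊤ : Submodule (IwasawaAlgebra p) D.X)) :=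
    fun n ↦ by rw [natCard_layerQuotient_omega_eq_natCard_selmerInvariants W κ hγ D n]; exact hpos n
  obtain ⟨h0, hΨ⟩ := (forall_natCard_quotient_omega_pos_iff (M := D.X) hD hchar).mp hpos'
  -- the base factor `#(X/TX) = #Sel_∞^Γ = p^{v+2k+s}`
  have hbase : Nat.card (D.X ⧸ (Ideal.span {(PowerSeries.X : IwasawaAlgebra p)} • ⊤ : Submodule (IwasawaAlgebra p) D.X)) = p ^ (padicValNat p W.tamagawaProduct + 2 * k + s) := by
    have e := natCard_layerQuotient_omega_eq_natCard_selmerInvariants W κ hγ D 0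
    rw [pow_zero, pow_one, add_sub_cancel_left] at e
    rw [e, natCard_selmerInvariants_zero_eq_pow_of_pure W κ hgo hκ hγ hK hN D hs]
  rw [← natCard_layerQuotient_omega_eq_natCard_selmerInvariants W κ hγ D n, natCard_quotient_omega_eq_mul_prod hD hnf hchar h0 (fun m _ ↦ hΨ m), hbase]
  congr 1
  refine Finset.prod_congr rfl fun m _ ↦ ?_
  exact natCard_quotient_smul_top_eq_natCard_quotient_span_sup (constantCoeff_cyclotomicLayer p m) (prime_coe_cyclotomic_comp p m) hD hnf hchar (hΨ m)

/-- ★★★ **THE HONEST LAYER NUMBERS: `#Sel_{p^∞}(W/ℚ_n)·#ker g_n = p^{v+2k+s} · ∏_{m<n} #Λ/(f_X, Ψ_m)` at every layer** (hypotheses as above, the rank-`0` tower in honest terms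
`∀ n, 0 < #Sel_{p^∞}(W/ℚ_n)·#ker g_n`; `#ker h_n = 1` on the cell). [cite: GreenbergLNM1716, §4 Thm. 4.1, Lemmas 4.2–4.3, Prop. 4.14] [cite: Washington1997, §13.3 Lemma 13.18] -/
theorem natCard_selmerLayer_mul_kerG_eq_pow_mul_prod_of_pure (hgo : GoodOrd W p) (hκ : κ.IsCyclotomic) (hγ : κ.IsTopGenerator γ) (hK : ∀ P : W.toAffine.Point, p • P = 0 → P = 0)
    {k : ℕ} (hN : W.reductionPointCount p = p ^ k) (D : W.SelmerDualData κ γ) [hSel : Finite (W.selmerGroupPInfty p)] {s : ℕ} (hs : Nat.card (W.selmerGroupPInfty p) = p ^ s)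
    {f : IwasawaAlgebra p} (hchar : D.charIdeal = Ideal.span {f}) (hpos : ∀ n, 0 < Nat.card ↥(W.selmerLayer κ n) * Nat.card (W.KerG κ n)) (n : ℕ) :
    Nat.card ↥(W.selmerLayer κ n) * Nat.card (W.KerG κ n) =
      p ^ (padicValNat p W.tamagawaProduct + 2 * k + s) *
        ∏ m ∈ Finset.range n, Nat.card (IwasawaAlgebra p ⧸ (Ideal.span {f} ⊔
          Ideal.span {((((Polynomial.cyclotomic (p ^ (m + 1)) ℤ_[p]).comp (Polynomial.X + 1) : ℤ_[p][X]) : IwasawaAlgebra p))})) := by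
  have h43 : ∀ n, Nat.card ↥(W.selmerInfty κ ⊓ W.layerInvariants κ n) * Nat.card (W.layerToInfty κ n).ker = Nat.card ↥(W.selmerLayer κ n) * Nat.card (W.KerG κ n) :=
    fun n ↦ W.natCard_selmerInvariants_mul_natCard_ker_layerToInfty κ n
  have hh : ∀ n, Nat.card (W.layerToInfty κ n).ker = 1 := fun n ↦ natCard_ker_layerToInfty_eq_one W κ (fun P hP ↦ hK P (by convert hP using 10)) n
  have hS : ∀ n, 0 < Nat.card ↥(W.selmerInfty κ ⊓ W.layerInvariants κ n) := fun n ↦ by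
    have h := hpos n
    rw [← h43 n] at h
    exact Nat.pos_of_mul_pos_right h
  rw [← h43 n, hh n, mul_one]
  exact natCard_selmerInvariants_eq_pow_mul_prod_of_pure W κ hgo hκ hγ hK hN D hs hchar hS n

end Rat

/-! ## §2 `p = 2`: the seed cell of C2 -/

section Two

variable (W : WeierstrassCurve ℚ) [W.IsElliptic] [W.IsGloballyMinimal] (κ₂ : ZpExtension ℚ 2) {γ : Field.absoluteGaloisGroup ℚ}

/-- ★★★ **THE SEED'S HONEST LAYER NUMBERS: `#Sel_{2^∞}(W/ℚ_n)·#ker g_n = 2^{𝔢} · ∏_{m<n} #Λ/(f_X, Ψ_m)` at EVERY layer**, `𝔢 = ord₂ Tam(W) + 2·ord₂ #W̃(𝔽₂) + s` — `W/ℚ` globally minimal, good ORDINARY at `2`,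
no rational `2`-torsion abscissa (C2's binder), `κ` cyclotomic with generator `γ`, ANY dual datum with `char_Λ X = (f_X)`, `#Sel_{2^∞}(W/ℚ) = 2^s`, every `#Sel_{2^∞}(W/ℚ_n)·#ker g_n > 0`. No hypothesis on
finite submodules (file XIII), no print binder. [cite: GreenbergLNM1716, §4 Thm. 4.1, Lemmas 4.2–4.3, Prop. 4.14] [cite: Washington1997, §13.3 Lemma 13.18] -/
theorem natCard_selmerLayer_mul_kerG_eq_seed (hgo : GoodOrd W 2) (ht : ∀ x : ℚ, ¬ Greenberg1999.HasRationalTwoTorsionX W x) (hκ : κ₂.IsCyclotomic) (hγ : κ₂.IsTopGenerator γ)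
    (D : W.SelmerDualData κ₂ γ) [hSel : Finite (W.selmerGroupPInfty 2)] {s : ℕ} (hs : Nat.card (W.selmerGroupPInfty 2) = 2 ^ s) {f : IwasawaAlgebra 2}
    (hchar : D.charIdeal = Ideal.span {f}) (hpos : ∀ n, 0 < Nat.card ↥(W.selmerLayer κ₂ n) * Nat.card (W.KerG κ₂ n)) (n : ℕ) :
    Nat.card ↥(W.selmerLayer κ₂ n) * Nat.card (W.KerG κ₂ n) =
      2 ^ (padicValNat 2 W.tamagawaProduct + 2 * padicValNat 2 (W.reductionPointCount 2) + s) *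
        ∏ m ∈ Finset.range n, Nat.card (IwasawaAlgebra 2 ⧸ (Ideal.span {f} ⊔
          Ideal.span {((((Polynomial.cyclotomic (2 ^ (m + 1)) ℤ_[2]).comp (Polynomial.X + 1) : ℤ_[2][X]) : IwasawaAlgebra 2))})) := by
  exact natCard_selmerLayer_mul_kerG_eq_pow_mul_prod_of_pure W κ₂ hgo hκ hγ (forall_two_nsmul_eq_zero W ht) (GoodOrdTower.reductionPointCount_two_eq_pow W hgo) D hs hchar hpos n

/-- ★★ **THE LAYER EXPONENTS OF A SEED**: under the hypotheses of `natCard_selmerLayer_mul_kerG_eq_seed` there is a sequence `v : ℕ → ℕ` with `1 ≤ v m` and `#Λ/(f_X, Ψ_m) = 2^{v m}` for every `m`,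
and **`#Sel_{2^∞}(W/ℚ_n)·#ker g_n = 2^{𝔢 + Σ_{m<n} v m}`** for every `n` (`v m = ord₂ N_{ℚ₂(ζ_{2^{m+1}})/ℚ₂} f_X(ζ_{2^{m+1}} − 1)`; `≥ 1` since `f_X, Ψ_m ∈ 𝔪_Λ`, file XII).
[cite: GreenbergLNM1716, Conj. 1.11, §4 Thm. 4.1] [cite: Washington1997, §7.1, §13.3] -/
theorem exists_layerExponents_seed (hgo : GoodOrd W 2) (ht : ∀ x : ℚ, ¬ Greenberg1999.HasRationalTwoTorsionX W x) (hκ : κ₂.IsCyclotomic) (hγ : κ₂.IsTopGenerator γ)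
    (D : W.SelmerDualData κ₂ γ) [hSel : Finite (W.selmerGroupPInfty 2)] {s : ℕ} (hs : Nat.card (W.selmerGroupPInfty 2) = 2 ^ s) {f : IwasawaAlgebra 2}
    (hchar : D.charIdeal = Ideal.span {f}) (hpos : ∀ n, 0 < Nat.card ↥(W.selmerLayer κ₂ n) * Nat.card (W.KerG κ₂ n)) :
    ∃ v : ℕ → ℕ, (∀ m, 1 ≤ v m ∧ Nat.card (IwasawaAlgebra 2 ⧸ (Ideal.span {f} ⊔
        Ideal.span {((((Polynomial.cyclotomic (2 ^ (m + 1)) ℤ_[2]).comp (Polynomial.X + 1) : ℤ_[2][X]) : IwasawaAlgebra 2))})) = 2 ^ v m) ∧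
      ∀ n, Nat.card ↥(W.selmerLayer κ₂ n) * Nat.card (W.KerG κ₂ n) =
        2 ^ (padicValNat 2 W.tamagawaProduct + 2 * padicValNat 2 (W.reductionPointCount 2) + s + ∑ m ∈ Finset.range n, v m) := by
  haveI : Module.Finite (IwasawaAlgebra 2) D.X := D.module_finite_holds hγ
  have hD : D.IsTorsion := D.isTorsion_of_finite_selmerGroup_rat hκ (W.hasGoodReductionAt_and_hasUnitRootAt_of_rat hgo.1 hgo.2) hγ hSel
  have hK : ∀ P : W.toAffine.Point, 2 • P = 0 → P = 0 := forall_two_nsmul_eq_zero W ht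
  -- the rank-0 tower binders `f(0) ≠ 0`, `Ψ_m ∤ f`
  have h43 : ∀ n, Nat.card ↥(W.selmerInfty κ₂ ⊓ W.layerInvariants κ₂ n) * Nat.card (W.layerToInfty κ₂ n).ker = Nat.card ↥(W.selmerLayer κ₂ n) * Nat.card (W.KerG κ₂ n) :=
    fun n ↦ W.natCard_selmerInvariants_mul_natCard_ker_layerToInfty κ₂ n
  have hS : ∀ n, 0 < Nat.card ↥(W.selmerInfty κ₂ ⊓ W.layerInvariants κ₂ n) := fun n ↦ by
    have h := hpos n
    rw [← h43 n] at h
    exact Nat.pos_of_mul_pos_right h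
  have hpos' : ∀ n, 0 < Nat.card (D.X ⧸ (Ideal.span {((1 + PowerSeries.X : PowerSeries ℤ_[2]) ^ (2 ^ n) - 1 : IwasawaAlgebra 2)} • ⊤ : Submodule (IwasawaAlgebra 2) D.X)) :=
    fun n ↦ by rw [natCard_layerQuotient_omega_eq_natCard_selmerInvariants W κ₂ hγ D n]; exact hS n
  obtain ⟨-, hΨ⟩ := (forall_natCard_quotient_omega_pos_iff (M := D.X) hD hchar).mp hpos'
  -- `f(0)` is not a unit: `ord₂ f(0) = 𝔢 ≥ 2`
  obtain ⟨-, -, hval⟩ := constantCoeff_ne_zero_and_valuation_add_eq W κ₂ hgo hκ hγ D hchar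
  have he := one_le_padicValNat_natCard_primaryComponent_reduction_two W hgo
  rw [natCard_primaryComponent_eq_one_of_noPTorsion W hK, padicValNat_one_right, mul_zero, add_zero] at hval
  have hf : ¬ IsUnit (PowerSeries.constantCoeff f) := by
    intro hu
    have hu1 : ‖PowerSeries.constantCoeff f‖ = 1 := PadicInt.isUnit_iff.mp hu
    have hn := PadicInt.norm_eq_zpow_neg_valuation hu.ne_zero
    rw [hu1, eq_comm, zpow_eq_one_iff_right₀ (by norm_num) (by norm_num)] at hn
    omega
  -- the exponents
  have hv : ∀ m, ∃ e : ℕ, 1 ≤ e ∧ Nat.card (IwasawaAlgebra 2 ⧸ (Ideal.span {f} ⊔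
      Ideal.span {((((Polynomial.cyclotomic (2 ^ (m + 1)) ℤ_[2]).comp (Polynomial.X + 1) : ℤ_[2][X]) : IwasawaAlgebra 2))})) = 2 ^ e := fun m ↦ by
    obtain ⟨e, he'⟩ := exists_natCard_quotient_span_sup_span_coe_eq_pow (constantCoeff_cyclotomicLayer 2 m) (prime_coe_cyclotomic_comp 2 m) (hΨ m)
    have hdvd := p_dvd_natCard_quotient_span_sup_span_coe (constantCoeff_cyclotomicLayer 2 m) (prime_coe_cyclotomic_comp 2 m) (hΨ m) hf
    rw [he'] at hdvd
    refine ⟨e, ?_, he'⟩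
    by_contra h0
    have : e = 0 := by omega
    rw [this, pow_zero] at hdvd
    exact absurd (Nat.le_of_dvd Nat.one_pos hdvd) (by norm_num)
  choose v hv1 hv2 using hv
  refine ⟨v, fun m ↦ ⟨hv1 m, hv2 m⟩, fun n ↦ ?_⟩
  rw [natCard_selmerLayer_mul_kerG_eq_seed W κ₂ hgo ht hκ hγ D hs hchar hpos n, Finset.prod_congr rfl (fun m _ ↦ hv2 m), Finset.prod_pow_eq_pow_sum, ← pow_add]

end Two

/-! ## §3 `p = 2`: the exact one-layer law and the `(μ, λ)`-reading of a seed -/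

section Reading

variable (W : WeierstrassCurve ℚ) [W.IsElliptic] [W.IsGloballyMinimal] (κ₂ : ZpExtension ℚ 2) {γ : Field.absoluteGaloisGroup ℚ}

/-- ★★★ **THE EXACT ONE-LAYER LAW ON THE SEED CELL: `#Sel_{2^∞}(W/ℚ_{n+1})·#ker g_{n+1} = 2^{2ⁿ·μ₂ + λ₂} · #Sel_{2^∞}(W/ℚ_n)·#ker g_n` for EVERY `n` with `λ₂ < 2ⁿ`** — `W/ℚ` globally minimal, good
ORDINARY at `2`, no rational `2`-torsion abscissa, `κ` cyclotomic with generator `γ`, ANY dual datum `D` (`μ₂ = μ(X)`, `λ₂ = λ(X)`), `#Sel_{2^∞}(W/ℚ) = 2^s`, rank-`0` tower in honest terms.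
Gen 56's exact law `#(X/ω_{n+1}X) = p^{pⁿ(p−1)μ+λ}·#(X/ω_nX)` (`…LayerIndexGrowthExact.natCard_quotient_omega_succ_eq_pow_mul`, displayed for the largest finite submodule `F` with `ω_n F = 0`)
with `F = 0` by file XIII, read through Lemma 4.3 (`#ker h = 1` on the cell). [cite: GreenbergLNM1716, Thm. 1.10, §4 Lemma 4.3, Prop. 4.14] [cite: Washington1997, §13.3 Thm. 13.13] -/
theorem natCard_selmerLayer_succ_mul_kerG_eq_seed (hgo : GoodOrd W 2) (ht : ∀ x : ℚ, ¬ Greenberg1999.HasRationalTwoTorsionX W x) (hκ : κ₂.IsCyclotomic) (hγ : κ₂.IsTopGenerator γ)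
    (D : W.SelmerDualData κ₂ γ) [hSel : Finite (W.selmerGroupPInfty 2)] {s : ℕ} (hs : Nat.card (W.selmerGroupPInfty 2) = 2 ^ s)
    (hpos : ∀ n, 0 < Nat.card ↥(W.selmerLayer κ₂ n) * Nat.card (W.KerG κ₂ n)) {n : ℕ} (hlam : D.lambda < 2 ^ n) :
    Nat.card ↥(W.selmerLayer κ₂ (n + 1)) * Nat.card (W.KerG κ₂ (n + 1)) = 2 ^ (2 ^ n * D.mu + D.lambda) * (Nat.card ↥(W.selmerLayer κ₂ n) * Nat.card (W.KerG κ₂ n)) := by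
  haveI : Module.Finite (IwasawaAlgebra 2) D.X := D.module_finite_holds hγ
  have hD : D.IsTorsion := D.isTorsion_of_finite_selmerGroup_rat hκ (W.hasGoodReductionAt_and_hasUnitRootAt_of_rat hgo.1 hgo.2) hγ hSel
  have hK : ∀ P : W.toAffine.Point, 2 • P = 0 → P = 0 := forall_two_nsmul_eq_zero W ht
  obtain ⟨f, hf0, hchar⟩ := exists_charGenerator_ne_zero D.X hD
  -- the rank-0 tower binders
  have h43 : ∀ n, Nat.card ↥(W.selmerInfty κ₂ ⊓ W.layerInvariants κ₂ n) * Nat.card (W.layerToInfty κ₂ n).ker = Nat.card ↥(W.selmerLayer κ₂ n) * Nat.card (W.KerG κ₂ n) :=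
    fun n ↦ W.natCard_selmerInvariants_mul_natCard_ker_layerToInfty κ₂ n
  have hh : ∀ n, Nat.card (W.layerToInfty κ₂ n).ker = 1 := fun n ↦ natCard_ker_layerToInfty_eq_one W κ₂ (fun P hP ↦ hK P (by convert hP using 10)) n
  have hS : ∀ n, 0 < Nat.card ↥(W.selmerInfty κ₂ ⊓ W.layerInvariants κ₂ n) := fun n ↦ by
    have h := hpos n
    rw [← h43 n] at h
    exact Nat.pos_of_mul_pos_right h
  have hpos' : ∀ n, 0 < Nat.card (D.X ⧸ (Ideal.span {((1 + PowerSeries.X : PowerSeries ℤ_[2]) ^ (2 ^ n) - 1 : IwasawaAlgebra 2)} • ⊤ : Submodule (IwasawaAlgebra 2) D.X)) :=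
    fun n ↦ by rw [natCard_layerQuotient_omega_eq_natCard_selmerInvariants W κ₂ hγ D n]; exact hS n
  obtain ⟨h0, hΨ⟩ := (forall_natCard_quotient_omega_pos_iff (M := D.X) hD hchar).mp hpos'
  -- the largest finite submodule is `0` (file XIII)
  haveI : IsNoetherian (IwasawaAlgebra 2) D.X := inferInstance
  obtain ⟨F, hFfin, hFmax⟩ := exists_finite_submodule_forall_finite_le (R := IwasawaAlgebra 2) (M := D.X)
  haveI : Finite F := hFfin
  have hF := forall_finite_eq_bot_quotient_of_forall_finite_le F hFmax
  have hFbot : F = ⊥ := forall_finite_submodule_eq_bot_seed W κ₂ hgo ht hκ hγ D hs F hFfin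
  have hFω : ∀ x ∈ F, (((1 + PowerSeries.X : PowerSeries ℤ_[2]) ^ (2 ^ n) - 1 : IwasawaAlgebra 2)) • x = 0 := fun x hx ↦ by
    rw [hFbot, Submodule.mem_bot] at hx
    rw [hx, smul_zero]
  -- `μ(f) = μ(X)`, `λ(f) = λ(X)`
  have hmu : mu f = D.mu := mu_generator_eq_muInvariant D.X hD hf0 hchar
  have hla : lam f = D.lambda := lam_generator_eq_lambdaInvariant D.X hD hf0 hchar
  have hlam' : lam f < 2 ^ n * (2 - 1) := by rw [hla]; simpa using hlam
  have hexact := natCard_quotient_omega_succ_eq_pow_mul hD F hF hchar h0 (fun m _ ↦ hΨ m) hlam' hFω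
  rw [natCard_layerQuotient_omega_eq_natCard_selmerInvariants W κ₂ hγ D (n + 1), natCard_layerQuotient_omega_eq_natCard_selmerInvariants W κ₂ hγ D n, hmu, hla,
    show 2 ^ n * (2 - 1) * D.mu = 2 ^ n * D.mu by norm_num] at hexact
  rw [← h43 (n + 1), ← h43 n, hh (n + 1), hh n, mul_one, mul_one]
  exact hexact

/-- ★★★ **THE ONE-LAYER EXACT DOOR ON THE SEED CELL: for any `n` with `λ₂(W) < 2ⁿ`, `μ₂(W) = 0 ⟺ #Sel_{2^∞}(W/ℚ_{n+1})·#ker g_{n+1} < 2^{2ⁿ} · #Sel_{2^∞}(W/ℚ_n)·#ker g_n`** (hypotheses of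
`natCard_selmerLayer_succ_mul_kerG_eq_seed`). NECESSARY AND SUFFICIENT at one specified pair of consecutive layers — the gens 55–57 doors (`… < 2^{2ⁿ} ⟹ μ = 0`) were sufficient;
with Kato's `λ₂ ≤ λ_an` (PRINT) the layer is chosen from the analytic side (`λ_an = 2 ⇒ n = 2`). [cite: GreenbergLNM1716, Conj. 1.11, Thm. 1.10, §4 Lemma 4.3] [cite: Washington1997, §13.3 Thm. 13.13] -/
theorem mu_eq_zero_iff_layer_seed (hgo : GoodOrd W 2) (ht : ∀ x : ℚ, ¬ Greenberg1999.HasRationalTwoTorsionX W x) (hκ : κ₂.IsCyclotomic) (hγ : κ₂.IsTopGenerator γ)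
    (D : W.SelmerDualData κ₂ γ) [hSel : Finite (W.selmerGroupPInfty 2)] {s : ℕ} (hs : Nat.card (W.selmerGroupPInfty 2) = 2 ^ s)
    (hpos : ∀ n, 0 < Nat.card ↥(W.selmerLayer κ₂ n) * Nat.card (W.KerG κ₂ n)) {n : ℕ} (hlam : D.lambda < 2 ^ n) :
    D.mu = 0 ↔ Nat.card ↥(W.selmerLayer κ₂ (n + 1)) * Nat.card (W.KerG κ₂ (n + 1)) < 2 ^ (2 ^ n) * (Nat.card ↥(W.selmerLayer κ₂ n) * Nat.card (W.KerG κ₂ n)) := by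
  have hex := natCard_selmerLayer_succ_mul_kerG_eq_seed W κ₂ hgo ht hκ hγ D hs hpos hlam
  have hN := hpos n
  rw [hex]
  constructor
  · intro hμ
    rw [hμ, mul_zero, zero_add]
    exact Nat.mul_lt_mul_of_pos_right (Nat.pow_lt_pow_right (by norm_num) hlam) hN
  · intro hlt
    by_contra hμ
    have h1 : 2 ^ (2 ^ n) ≤ 2 ^ (2 ^ n * D.mu + D.lambda) :=
      Nat.pow_le_pow_right (by norm_num) (le_trans (by nlinarith [Nat.one_le_iff_ne_zero.mpr hμ, Nat.one_le_two_pow (n := n)]) (Nat.le_add_right _ _))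
    exact absurd hlt (not_lt.mpr (Nat.mul_le_mul_right _ h1))

/-- ★★ **THE `(μ, λ)`-READING: if `#Sel_{2^∞}(W/ℚ_{n+1})·#ker g_{n+1} = 2^e · #Sel_{2^∞}(W/ℚ_n)·#ker g_n` with `λ₂ < 2ⁿ`, then `μ₂ = e / 2ⁿ` and `λ₂ = e % 2ⁿ`** (hypotheses of
`natCard_selmerLayer_succ_mul_kerG_eq_seed`): two consecutive honest layer numbers of a seed read BOTH Iwasawa invariants by Euclidean division.
[cite: GreenbergLNM1716, Thm. 1.10, Conj. 1.11] [cite: Washington1997, §13.3 Thm. 13.13] -/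
theorem mu_eq_div_and_lambda_eq_mod_seed (hgo : GoodOrd W 2) (ht : ∀ x : ℚ, ¬ Greenberg1999.HasRationalTwoTorsionX W x) (hκ : κ₂.IsCyclotomic) (hγ : κ₂.IsTopGenerator γ)
    (D : W.SelmerDualData κ₂ γ) [hSel : Finite (W.selmerGroupPInfty 2)] {s : ℕ} (hs : Nat.card (W.selmerGroupPInfty 2) = 2 ^ s)
    (hpos : ∀ n, 0 < Nat.card ↥(W.selmerLayer κ₂ n) * Nat.card (W.KerG κ₂ n)) {n : ℕ} (hlam : D.lambda < 2 ^ n) {e : ℕ}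
    (he : Nat.card ↥(W.selmerLayer κ₂ (n + 1)) * Nat.card (W.KerG κ₂ (n + 1)) = 2 ^ e * (Nat.card ↥(W.selmerLayer κ₂ n) * Nat.card (W.KerG κ₂ n))) :
    D.mu = e / 2 ^ n ∧ D.lambda = e % 2 ^ n := by
  have hex := natCard_selmerLayer_succ_mul_kerG_eq_seed W κ₂ hgo ht hκ hγ D hs hpos hlam
  rw [he] at hex
  have h2 : 2 ^ e = 2 ^ (2 ^ n * D.mu + D.lambda) := Nat.eq_of_mul_eq_mul_right (hpos n) hex
  have h3 : e = 2 ^ n * D.mu + D.lambda := Nat.pow_right_injective (le_refl 2) h2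
  have hpow : 0 < 2 ^ n := Nat.two_pow_pos n
  refine ⟨?_, ?_⟩
  · rw [h3, Nat.mul_add_div hpow, Nat.div_eq_of_lt hlam, add_zero]
  · rw [h3, Nat.mul_add_mod, Nat.mod_eq_of_lt hlam]

end Reading

end Summit.BirchSwinnertonDyer.BirchSwinnertonDyer.Theorems.AlignedTransportAtTwoHalfDescentBaseIndexLayerNumbers

end
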